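import Summits.AtomisticToContinuum.BoseEinsteinCondensation.Theses.BECZeroCrossingDilute
import Literature.MathematicalPhysics.QuantumLattice.SpinChainsAkltCorrelationProofs
import Literature.MathematicalPhysics.QuantumLattice.SpinChargeKinematics
import Summits.AtomisticToContinuum.BoseEinsteinCondensation.Theorems.BECZeroCrossingDiluteNearIsotropicDiluteBECPenalisedPerron
import Summits.AtomisticToContinuum.BoseEinsteinCondensation.Theorems.BECZeroCrossingDiluteNearIsotropicDiluteBECPlanarDeficit
import Summits.AtomisticToContinuum.BoseEinsteinCondensation.Theorems.BECZeroCrossingDiluteNearIsotropicDiluteBECInterchangeComparison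
import Summits.AtomisticToContinuum.BoseEinsteinCondensation.Theorems.BECZeroCrossingDiluteNearIsotropicDiluteBECKineticVariational
import Summits.AtomisticToContinuum.BoseEinsteinCondensation.Theorems.BECZeroCrossingDiluteNearIsotropicDiluteBECGapWindow

/-!
# Birth skeleton (BC3) for crux `NearIsotropicDiluteBEC` — stmt-AtomisticToContinuum-13905
(route `BECZeroCrossingDilute`, rank 2; sub-problem `BoseEinsteinCondensation`)

**Lead reshape (prover-line-stmt-AtomisticToContinuum-13905-0, 2026-08-17, cycle 1).** Stub B
(`GapWindowPersistence`) is no longer a stub: it is the sorry-free theorem `gapWindow_of_parts` of three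
registered stubs — B1 `stub_planarDeficit : PlanarDeficitIdentity` (planar moment = `N(L³−N+1)` minus
half the ordered interchange deficit `Σ_{x,y}Re⟨ψ,(1−T_xy)ψ⟩`, `T_xy = permOp (Equiv.swap x y)`),
B2 `stub_interchangeComparison : InterchangeComparison` (all-pairs vs nearest-neighbour interchange
Dirichlet forms on `(ℤ/Lℤ)³`, factor `C·L⁵`), B3 `stub_kineticVariational : KineticVariationalBound`
(`Σ_{x~y}Re⟨ψ,(1−T_xy)ψ⟩ ≤ C(1−Δ)N²/L³` for unit sector ground vectors, by the variational principle
against the uniform sector vector). Registered stubs are now A, B1, B2, B3, C (5 ≤ stubs_max); the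
composition `NearIsotropicDiluteBEC_of` concludes the crux decl BY NAME. **Integration (cycle 1, same
day):** A, B1, B2, B3 LANDED (`Theorems/BECZeroCrossingDiluteNearIsotropicDiluteBEC{PenalisedPerron,
PlanarDeficit,InterchangeComparison,KineticVariational}.lean`, p148797 / p150317 / p151910 / p155200) and are
imported here; `gapWindow_holds : GapWindowPersistence` is proved from them; the composition now has the
single hypothesis `__Registered.stub_thermodynamicWindow` (stub C, the open core) and discharges A and B
inside the proof. The planner's text below is otherwise unchanged.

Planner `planner-skel-stmt-AtomisticToContinuum-13905-0`, 2026-08-17 (skeleton-register, re-audit bin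
REPAIRABLE). Published as `Cruxes/NearIsotropicDiluteBEC/Lines/birth.lean`; line card `Lines/birth.md`.

The crux: there are `ε, ν₀ > 0` such that for every `L ≥ 2`, every `N ≤ ν₀L³` and every
`Δ ∈ [1 − ε, 1]` the tracial ground state `ω` of the penalised easy-plane XXZ ferromagnet
`K_L(N,Δ) = H_Δ + 4L³·(S³_tot + (L³/2 − N))²` on `(ℤ/Lℤ)³` (`H_Δ = −Σ_⟨xy⟩(S¹S¹ + S²S² + Δ S³S³)`,
the `N`-boson sector of the hard-core lattice gas) keeps half of the exact `SU(2)` condensate: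
`N(L³ − N + 1) ≤ 2·B_L(N,Δ)`, `B_L = Re ω((S¹_tot)² + (S²_tot)²) + N − L³/2 = ⟨S⁺_tot S⁻_tot⟩_ω`.
With `a(Δ) ≈ 0.477(1−Δ)` the magnon scattering length and `ν = N/L³`, LSSY's Gross–Pitaevskii
parameter is `g = Na/L ∝ (1−Δ)N/L`, and the skeleton cuts the crux exactly along `g`:

* `stub_penalisedPerron : PenalisedSectorPerron` — PENALTY SELECTION + PERRON–FROBENIUS (size L,
  provable now): for `L ≥ 2`, `N ≤ L³`, `0 ≤ Δ ≤ 1` the ground space of `K_L(N,Δ)` is the complex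
  line through ONE unit, entrywise-nonnegative vector `φ` annihilated by the sector selector
  `S³_tot + (L³/2 − N)` (penalty `4L³` > spectral width `≤ 3L³` of `H_Δ`, bond width `1` for
  `|Δ| ≤ 1`; inside the sector `H_Δ` has off-diagonal entries `−½ ≤ 0` on the connected
  `N`-token graph of the torus). It is the XXZ twin of the LANDED XY theorems
  `SectorGroundStatePerron_proof`, `PenaltySelectsSector_proof` and
  `LatticeCoherence.groundState_penalised` (route BECStronglyRayleigh), and of this route's own
  support `PenaltySelectsSectorXXZ` (stmt-AtomisticToContinuum-13908); it converts the tracial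
  functional of the crux into the vector state of `φ` (`groundStateFunctional_eq_of_hasUniqueGroundState`).
* `stub_gapWindow : GapWindowPersistence` — the KINETIC-GAP (Gross–Pitaevskii) WINDOW (size L–XL,
  provable now): there is `κ > 0` such that for `L ≥ 2`, `2N ≤ L³`, `0 ≤ Δ ≤ 1` and
  `(1−Δ)·N ≤ κ·L` every unit sector ground vector `ψ` of `K_L(N,Δ)` obeys the crux inequality
  `N(L³−N+1) ≤ 2(Re⟨ψ,Qψ⟩ + N − L³/2)`, `Q = (S¹_tot)² + (S²_tot)²`. Mechanism (the lattice twin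
  of LSSY2005 Ch. 5 (5.15)×L²): the spin deficit `S_max(S_max+1) − 𝐒²_tot = Σ_{x<y}(1 − T_xy)`
  (`T_xy` = transposition; its `ψ`-expectation IS `N(L³−N+1) − ⟨S⁺_totS⁻_tot⟩_ψ` on the sector) is
  dominated, by canonical paths on the torus (Diaconis–Saloff-Coste comparison of interchange
  Dirichlet forms), by `c·L³·L²·(H_1 − E₀(H_1)) = c·L⁵·½Σ_{⟨xy⟩}(1 − T_xy)`; and the variational
  principle against the uniform sector vector `ψ₁` (a global ground state of the isotropic `H_1`,
  `H_Δ = H_1 + (1−Δ)Σ_⟨xy⟩S³S³`) gives `⟨ψ,(H_1 − E₀)ψ⟩ ≤ (1−Δ)(⟨P⟩_{ψ₁} − ⟨P⟩_ψ) ≤ 3(1−Δ)N²/L³`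
  (`P` = number of up–up bonds `≥ 0`, `⟨P⟩_{ψ₁} = |E|N(N−1)/(L³(L³−1))`). Hence the deficit is
  `≤ 3c(1−Δ)N²L²`, which is `≤ ¼NL³ ≤ ½N(L³−N+1)` exactly when `(1−Δ)N ≤ L/(12c)`.
  This is the statement INSIDE the catalogued barrier `KineticGapLengthScales` (box ≲ healing
  length, `g = Na/L` bounded) — filed as what that technique class provably delivers here.
* `stub_thermodynamicWindow : ThermodynamicWindowPersistence` — the THERMODYNAMIC WINDOW (the open
  core; size XL/open): for every `κ > 0` there are `ε, ν₀ > 0` such that for `L ≥ 2`, `N ≤ ν₀L³`,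
  `Δ ∈ [1−ε, 1]` and `κ·L ≤ (1−Δ)·N` (box ≳ healing length `ξ ∼ (ν a)^{-1/2}`) the unit
  NONNEGATIVE sector ground vector `ψ` of `K_L(N,Δ)` obeys the same inequality. Expected output of
  any proof along the route's thesis (bounded diagonal deformation `(1−Δ)Σ S³S³` of the exactly
  condensed `SU(2)` multiplet, small parameter `Y = ν a(Δ)³`, Ward identity of the residual `U(1)`,
  lattice UV): the Bogoliubov-rate deficit `N(L³−N+1) − ⟨S⁺S⁻⟩_ψ ≲ N L³ √(ν a(Δ)³)`, far below the
  budget `¼NL³`. It is implied by the crux together with stub A (so it is NECESSARY for the line and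
  no more refutable than the crux), it does not imply the crux without stub B (probes below), and
  by construction it lies OUTSIDE the technique class of `KineticGapLengthScales` /
  `BogoliubovPerturbationInfrared` (why it might fail: it is the marginal `d = 3`, `T = 0` infrared
  problem — no volume-uniform construction of a `U(1)`-broken Bose ground state exists; Benfatto
  1994 `n!` bounds, Balaban–Feldman–Knörrer–Trubowitz incomplete).

Composition `NearIsotropicDiluteBEC_of : PenalisedSectorPerron → GapWindowPersistence →
ThermodynamicWindowPersistence → NearIsotropicDiluteBEC` (hypotheses spelled `__Registered.stub_X`,
`rfl`-aliases keyed by the stub names, the device of `Cruxes/AmplitudeLDP/Lines/birth.lean`, so that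
the native `#h21_check_skeleton` admits them) is PROVED below without `sorry`: take `κ` from B,
`(ε, ν₀)` from C at that `κ`, answer the crux with `(min ε 1, min ν₀ ½)`; for given `(L, N, Δ)` take
the Perron vector `φ` of A, split on `(1−Δ)N ≤ κL` (B) / `κL < (1−Δ)N` (C) to get the inequality
for the vector state of `φ`, and identify the tracial ground-state functional of `K_L(N,Δ)` with that
vector state (`groundSpace = ℂφ`, `finrank_span_singleton`,
`groundStateFunctional_eq_of_hasUniqueGroundState`). It concludes the route decl
`Summit.AtomisticToContinuum.BoseEinsteinCondensation.Theses.BECZeroCrossingDilute.NearIsotropicDiluteBEC`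
BY NAME; sorries live only in the three `stub_*` theorems.

Disproof used: none relevant — `ledger crux ls stmt-AtomisticToContinuum-13905` showed no workfiles
(no `Disproof.lean`, no `Lines/*`), there is no `Theorems/NearIsotropicDiluteBEC/Negative/`, and the
negatives index of the summit (20 entries, 2 on this sub-problem: stmt-14490 BerryStiffPhaseLRO,
stmt-3980 SwapJensen) has no statement about the XXZ / zero-crossing line (2026-08-17). Refuter
evidence on the item (crux-attack 2026-08-15, `evidence-13905.md`): SURVIVES; sector ED for
`L = 2…6`, `N ≤ 4`, `Δ ∈ {0,.5,.9,.99,1}` gives `2B/(N(V−N+1)) ∈ [1.8995, 2]`, `= 2` at `Δ = 1` —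
consistent with all three stubs (A: unique positive sector ground state; B/C: ratio ≥ 1).
Degenerate audit: `N = 0` (all spins down: `⟨Q⟩ = L³/2`, both sides `0`), `N = 1` (zero-momentum
magnon, `⟨S⁺S⁻⟩ = L³ = N(L³−N+1)`), `Δ = 1` (exact `SU(2)` condensate, equality — support
`AnchorExact`, stmt-13907): B and C hold with equality or slack there; `L = 2` (cube graph `Q₃`,
degree 3) is inside every statement's range and harmless (`N ≤ ν₀·8`).

BC3 audit (planner folder `bc/`, 2026-08-17, farm `lean check --json`): this file rc 0, errors [],
sorries 3 = the three `stub_*` (the three `declaration uses sorry` warnings sit exactly on the stub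
theorems), `#print axioms NearIsotropicDiluteBEC_of` = [propext, Classical.choice, Quot.sound] (no
`sorryAx`). Probes (files `bc/<Stub>_probe.lean`, stub defs only, 10 examples each): for every stub
`S ∈ {PenalisedSectorPerron, GapWindowPersistence, ThermodynamicWindowPersistence}` both
`S → NearIsotropicDiluteBEC` and `S → _root_.BoseEinsteinCondensation` by
`first | exact? | simpa [S] | (unfold S; simpa) | aesop` FAIL, in the combined form and for each
alternative separately (`exact?`: "could not close the goal"; `simpa`/`unfold; simpa`: "Tactic
`assumption` failed"; `aesop`: "failed to prove the goal after exhaustive search") — 30/30 probes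
fail: no stub is cheaply the crux or the summit (raw diagnostics: `bc/probe_result_<Stub>.txt`,
attached as evidence with this file).
-/

noncomputable section

namespace Summit.AtomisticToContinuum.BoseEinsteinCondensation.Cruxes.NearIsotropicDiluteBEC.Birth

open scoped BigOperators Matrix ComplexOrder
open Literature.MathematicalPhysics.QuantumLattice Literature.Probability.LatticeModels Matrix
open Summit.AtomisticToContinuum.BoseEinsteinCondensation.Theses.BECZeroCrossingDilute

/-! ## The three operators of the crux (reducible abbreviations of the crux's own sub-terms) -/

/-- The penalised easy-plane XXZ ferromagnet `K_L(N,Δ) = H_Δ + 4L³·(S³_tot + (L³/2 − N)·1)²` on the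
torus `(ℤ/Lℤ)³`, `H_Δ = xxzHamiltonian 1 (torusGraph 3 L) (−1) Δ = −Σ_⟨xy⟩(S¹S¹ + S²S² + Δ S³S³)` —
verbatim the matrix whose `groundStateFunctional` the crux evaluates. -/
abbrev penalised (L : ℕ) [NeZero L] (N : ℕ) (Δ : ℝ) : Op (TorusSite 3 L) 2 :=
  xxzHamiltonian 1 (torusGraph 3 L) (-1) Δ +
    (((3 + 1) * L ^ 3 : ℕ) : ℂ) • (totalSpin 1 2 + ((L : ℂ) ^ 3 / 2 - (N : ℂ)) • 1) ^ 2

/-- The sector selector `S³_tot + (L³/2 − N)·1`; its kernel is the magnetisation sector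
`S³_tot = N − L³/2` (`N` up-spins = `N` hard-core bosons). -/
abbrev sectorShift (L : ℕ) [NeZero L] (N : ℕ) : Op (TorusSite 3 L) 2 :=
  totalSpin 1 2 + ((L : ℂ) ^ 3 / 2 - (N : ℂ)) • 1

/-- The planar moment `Q = (S¹_tot)² + (S²_tot)²` (`= S⁺_tot S⁻_tot − S³_tot`), the crux's observable. -/
abbrev planarSq (L : ℕ) [NeZero L] : Op (TorusSite 3 L) 2 :=
  totalSpin 1 0 * totalSpin 1 0 + totalSpin 1 1 * totalSpin 1 1

/-! ## Stub statements -/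

/-- **Stub A — penalty selection + Perron–Frobenius for the penalised XXZ ferromagnet.** For
`L ≥ 2`, `N ≤ L³`, `0 ≤ Δ ≤ 1` there is a unit vector `φ`, entrywise real-nonnegative in the `S³`
product basis, annihilated by the sector selector and lying in the ground space of `K_L(N,Δ)`, such
that every ground vector of `K_L(N,Δ)` is a complex multiple of `φ` (the penalty `4L³` exceeds the
spectral width `≤ 3L³` of `H_Δ`, so ground vectors lie in the sector `S³_tot = N − L³/2`; there `H_Δ`
is a real symmetric matrix with off-diagonal entries `−½ ≤ 0` whose graph — `N` tokens sliding on the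
connected torus — is connected). XXZ twin of the landed `SectorGroundStatePerron_proof` /
`PenaltySelectsSector_proof` / `LatticeCoherence.groundState_penalised` (XY, `Δ = 0`). -/
def PenalisedSectorPerron : Prop :=
  ∀ (L : ℕ) [NeZero L], 2 ≤ L → ∀ N : ℕ, N ≤ L ^ 3 → ∀ Δ : ℝ, 0 ≤ Δ → Δ ≤ 1 →
    ∃ φ : TensorIndex (TorusSite 3 L) 2 → ℂ,
      (∀ σ, φ σ = ((‖φ σ‖ : ℝ) : ℂ)) ∧ star φ ⬝ᵥ φ = 1 ∧
      sectorShift L N *ᵥ φ = 0 ∧ φ ∈ (penalised L N Δ).groundSpace ∧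
      ∀ ψ : TensorIndex (TorusSite 3 L) 2 → ℂ, ψ ∈ (penalised L N Δ).groundSpace → ∃ c : ℂ, ψ = c • φ

/-- **Stub B — persistence in the kinetic-gap (Gross–Pitaevskii) window.** There is `κ > 0` such that
for `L ≥ 2`, `2N ≤ L³`, `0 ≤ Δ ≤ 1` with `(1−Δ)·N ≤ κ·L` (LSSY's `g = Na/L` bounded: box no larger
than the healing length) every unit ground vector `ψ` of `K_L(N,Δ)` in the sector satisfies the crux
inequality for its vector state: `N(L³−N+1) ≤ 2(Re⟨ψ,Qψ⟩ + N − L³/2)` (`= 2⟨S⁺_totS⁻_tot⟩_ψ`).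
Provable now: spin deficit `Σ_{x<y}(1−T_xy) ≤ c L⁵ · ½Σ_⟨xy⟩(1−T_xy) = cL⁵(H_1 − E₀)` by canonical
paths on the torus, and `⟨ψ,(H_1−E₀)ψ⟩ ≤ (1−Δ)·⟨P⟩_{ψ₁} ≤ 3(1−Δ)N²/L³` by the variational principle
against the uniform sector vector `ψ₁` (`H_Δ = H_1 + (1−Δ)ΣS³S³`, `P` = up–up bond count). -/
def GapWindowPersistence : Prop :=
  ∃ κ : ℝ, 0 < κ ∧ ∀ (L : ℕ) [NeZero L], 2 ≤ L → ∀ N : ℕ, 2 * (N : ℝ) ≤ (L : ℝ) ^ 3 →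
    ∀ Δ : ℝ, 0 ≤ Δ → Δ ≤ 1 → (1 - Δ) * (N : ℝ) ≤ κ * (L : ℝ) →
    ∀ ψ : TensorIndex (TorusSite 3 L) 2 → ℂ, ψ ∈ (penalised L N Δ).groundSpace →
      sectorShift L N *ᵥ ψ = 0 → star ψ ⬝ᵥ ψ = 1 →
      (N : ℝ) * ((L : ℝ) ^ 3 - N + 1) ≤
        2 * ((star ψ ⬝ᵥ planarSq L *ᵥ ψ).re + N - (L : ℝ) ^ 3 / 2)

/-- **Stub B1 — the planar moment is the full `SU(2)` condensate minus the interchange deficit.**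
For a unit vector `ψ` in the sector `S³_tot = N − L³/2` (`N ≤ L³`):
`Re⟨ψ,Qψ⟩ + N − L³/2 = N(L³ − N + 1) − ½ Σ_{x,y} Re⟨ψ,(1 − T_xy)ψ⟩`, where `T_xy = permOp (swap x y)`
transposes the spins at `x, y` (the sum is over ORDERED pairs; `x = y` contributes `0`). Algebra of
spin `½`: `T_xy = 2 𝐒_x·𝐒_y + ½` (`x ≠ y`), `𝐒² = ½Σ_{x,y}T_xy − L³(L³−2)/4`, `Q = 𝐒² − (S³)²`,
`S³ = N − L³/2` on the sector. Size M, provable now. -/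
def PlanarDeficitIdentity : Prop :=
  ∀ (L : ℕ) [NeZero L], 2 ≤ L → ∀ N : ℕ, N ≤ L ^ 3 →
    ∀ ψ : TensorIndex (TorusSite 3 L) 2 → ℂ, sectorShift L N *ᵥ ψ = 0 → star ψ ⬝ᵥ ψ = 1 →
      (star ψ ⬝ᵥ planarSq L *ᵥ ψ).re + N - (L : ℝ) ^ 3 / 2 =
        (N : ℝ) * ((L : ℝ) ^ 3 - N + 1) -
          1 / 2 * ∑ x : TorusSite 3 L, ∑ y : TorusSite 3 L,
            (star ψ ⬝ᵥ ((1 : Op (TorusSite 3 L) 2) - permOp (Equiv.swap x y)) *ᵥ ψ).re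

/-- **Stub B2 — interchange Dirichlet-form comparison on the torus (canonical paths).** There is
`C > 0` such that for every `L ≥ 2` and every vector `ψ` on `(ℤ/Lℤ)³`:
`Σ_{x,y} Re⟨ψ,(1 − T_xy)ψ⟩ ≤ C·L⁵ · Σ_{x ~ y} Re⟨ψ,(1 − T_xy)ψ⟩` (both sums over ordered pairs, the
second over adjacent ones). Mechanism: `Re⟨ψ,(1−T)ψ⟩ = ½‖(1−T)ψ‖²` for the unitary involution `T`;
`T_{ac} = T_{ab}T_{bc}T_{ab}` for distinct sites, so `‖(1−T_{v₀v_k})ψ‖ ≤ 2Σ_i ‖(1−T_{v_iv_{i+1}})ψ‖`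
along any vertex list (telescoping `1 − U₁⋯U_m = Σ_j U₁⋯U_{j−1}(1−U_j)`); route `x → z` by the three
axis-parallel legs (length `≤ 3L`), bound each leg's edges by its whole axis line and count: every line
is charged by `≤ L⁴` pairs, giving `C = 12`. Diaconis–Saloff-Coste (1993) comparison; pure
combinatorics, size L, provable now. -/
def InterchangeComparison : Prop :=
  ∃ C : ℝ, 0 < C ∧ ∀ (L : ℕ) [NeZero L], 2 ≤ L → ∀ ψ : TensorIndex (TorusSite 3 L) 2 → ℂ,
    ∑ x : TorusSite 3 L, ∑ y : TorusSite 3 L,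
        (star ψ ⬝ᵥ ((1 : Op (TorusSite 3 L) 2) - permOp (Equiv.swap x y)) *ᵥ ψ).re ≤
      C * (L : ℝ) ^ 5 * ∑ x : TorusSite 3 L, ∑ y : TorusSite 3 L,
        if (torusGraph 3 L).Adj x y then
          (star ψ ⬝ᵥ ((1 : Op (TorusSite 3 L) 2) - permOp (Equiv.swap x y)) *ᵥ ψ).re else 0

/-- **Stub B3 — variational bound on the kinetic (nearest-neighbour interchange) energy of the sector
ground state.** There is `C > 0` such that for `L ≥ 2`, `N ≤ L³`, `0 ≤ Δ ≤ 1` every unit sector ground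
vector `ψ` of `K_L(N,Δ)` has `Σ_{x ~ y} Re⟨ψ,(1 − T_xy)ψ⟩ ≤ C(1−Δ)N²/L³` (`C = 12` works). Mechanism:
`H_Δ = H_1 + (1−Δ)·diag(W)`, `W(σ) = Σ_{⟨xy⟩} s_x s_y` (`leadPF_ham_eq`), `H_1 + |E|/4 = ½Σ_{⟨xy⟩}(1 − T_xy) ≥ 0`
vanishing on the uniform sector vector `ψ₁`; `ψ` minimises `Re⟨φ,H_Δφ⟩` over unit sector vectors (the
penalty vanishes there), so `Σ_{⟨xy⟩}Re⟨ψ,(1−T)ψ⟩ = 2Re⟨ψ,(H_1+|E|/4)ψ⟩ ≤ 2(1−Δ)(⟨W⟩_{ψ₁} − ⟨W⟩_ψ)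
= 2(1−Δ)(⟨P⟩_{ψ₁} − ⟨P⟩_ψ) ≤ 2(1−Δ)⟨P⟩_{ψ₁}` (`P` = number of up–up bonds; the torus graph is regular so
the linear terms cancel on the sector), and `⟨P⟩_{ψ₁} = |E|·N(N−1)/(L³(L³−1)) ≤ 3N²/L³`. Size L,
provable now. -/
def KineticVariationalBound : Prop :=
  ∃ C : ℝ, 0 < C ∧ ∀ (L : ℕ) [NeZero L], 2 ≤ L → ∀ N : ℕ, N ≤ L ^ 3 → ∀ Δ : ℝ, 0 ≤ Δ → Δ ≤ 1 →
    ∀ ψ : TensorIndex (TorusSite 3 L) 2 → ℂ, ψ ∈ (penalised L N Δ).groundSpace →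
      sectorShift L N *ᵥ ψ = 0 → star ψ ⬝ᵥ ψ = 1 →
      (∑ x : TorusSite 3 L, ∑ y : TorusSite 3 L,
          if (torusGraph 3 L).Adj x y then
            (star ψ ⬝ᵥ ((1 : Op (TorusSite 3 L) 2) - permOp (Equiv.swap x y)) *ᵥ ψ).re else 0) ≤
        C * (1 - Δ) * (N : ℝ) ^ 2 / (L : ℝ) ^ 3

/-- **Stub C — persistence in the thermodynamic window (the open core of the crux).** For every
`κ > 0` there are `ε, ν₀ > 0` such that for `L ≥ 2`, `N ≤ ν₀L³`, `Δ ∈ [1−ε, 1]` with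
`κ·L ≤ (1−Δ)·N` (box at least a constant times the healing length) the unit, entrywise-nonnegative
ground vector `ψ` of `K_L(N,Δ)` in the sector satisfies `N(L³−N+1) ≤ 2(Re⟨ψ,Qψ⟩ + N − L³/2)`.
Expected mechanism: bounded diagonal deformation `(1−Δ)Σ S³S³` of the exactly condensed `SU(2)`
multiplet, small parameter `Y = ν a(Δ)³`, residual-`U(1)` Ward identity, lattice UV; expected output
the Bogoliubov-rate deficit `≲ N L³ √(ν a(Δ)³)`. Outside the technique class of
`Literature.Barriers.AtomisticToContinuum.KineticGapLengthScales` by construction; it IS the marginal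
`d = 3`, `T = 0` infrared problem (`BogoliubovPerturbationInfrared`). Necessary: implied by the crux
and stub A. -/
def ThermodynamicWindowPersistence : Prop :=
  ∀ κ : ℝ, 0 < κ → ∃ ε ν₀ : ℝ, 0 < ε ∧ 0 < ν₀ ∧ ∀ (L : ℕ) [NeZero L], 2 ≤ L →
    ∀ N : ℕ, (N : ℝ) ≤ ν₀ * (L : ℝ) ^ 3 → ∀ Δ : ℝ, 1 - ε ≤ Δ → Δ ≤ 1 →
    κ * (L : ℝ) ≤ (1 - Δ) * (N : ℝ) →
    ∀ ψ : TensorIndex (TorusSite 3 L) 2 → ℂ, ψ ∈ (penalised L N Δ).groundSpace →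
      sectorShift L N *ᵥ ψ = 0 → star ψ ⬝ᵥ ψ = 1 → (∀ σ, ψ σ = ((‖ψ σ‖ : ℝ) : ℂ)) →
      (N : ℝ) * ((L : ℝ) ^ 3 - N + 1) ≤
        2 * ((star ψ ⬝ᵥ planarSq L *ᵥ ψ).re + N - (L : ℝ) ^ 3 / 2)

/-! ## Registered stubs (signatures spelled in tree vocabulary; each is `rfl`-equal to the `def` above) -/

/-! ### Landed stubs (imported, sorry-free, `--supports stmt-AtomisticToContinuum-13905`)

* A  `stub_penalisedPerron`        — `Theorems/BECZeroCrossingDiluteNearIsotropicDiluteBECPenalisedPerron.lean` (p148797)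
* B1 `stub_planarDeficit`          — `Theorems/BECZeroCrossingDiluteNearIsotropicDiluteBECPlanarDeficit.lean` (p150317)
* B2 `stub_interchangeComparison`  — `Theorems/BECZeroCrossingDiluteNearIsotropicDiluteBECInterchangeComparison.lean` (p151910, `C = 144`)
* B3 `stub_kineticVariational`     — `Theorems/BECZeroCrossingDiluteNearIsotropicDiluteBECKineticVariational.lean` (p155200, `C = 12`)
* B  `stub_gapWindow`              — `Theorems/BECZeroCrossingDiluteNearIsotropicDiluteBECGapWindow.lean` (p156039; + tracial form `nearIsotropicDiluteBEC_kineticGapWindow`)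

Their registered signatures are restated below as `example`s checked against the imported theorems. -/

example : PenalisedSectorPerron := stub_penalisedPerron
example : PlanarDeficitIdentity := stub_planarDeficit
example : InterchangeComparison := stub_interchangeComparison
example : KineticVariationalBound := stub_kineticVariational

/-- stub C: the thermodynamic window `κL ≤ (1−Δ)N` (hardest stub; the open core of the crux).
Registered signature = `ThermodynamicWindowPersistence` spelled out in tree vocabulary. -/
theorem stub_thermodynamicWindow :
    ∀ κ : ℝ, 0 < κ → ∃ ε ν₀ : ℝ, 0 < ε ∧ 0 < ν₀ ∧ ∀ (L : ℕ) [NeZero L], 2 ≤ L →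
      ∀ N : ℕ, (N : ℝ) ≤ ν₀ * (L : ℝ) ^ 3 → ∀ Δ : ℝ, 1 - ε ≤ Δ → Δ ≤ 1 →
      κ * (L : ℝ) ≤ (1 - Δ) * (N : ℝ) →
      ∀ ψ : TensorIndex (TorusSite 3 L) 2 → ℂ,
        ψ ∈ (xxzHamiltonian 1 (torusGraph 3 L) (-1) Δ +
          (((3 + 1) * L ^ 3 : ℕ) : ℂ) • (totalSpin 1 2 + ((L : ℂ) ^ 3 / 2 - (N : ℂ)) • 1) ^ 2).groundSpace →
        ((totalSpin 1 2 : Op (TorusSite 3 L) 2) + ((L : ℂ) ^ 3 / 2 - (N : ℂ)) • 1) *ᵥ ψ = 0 → star ψ ⬝ᵥ ψ = 1 →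
        (∀ σ, ψ σ = ((‖ψ σ‖ : ℝ) : ℂ)) →
        (N : ℝ) * ((L : ℝ) ^ 3 - N + 1) ≤
          2 * ((star ψ ⬝ᵥ ((totalSpin 1 0 : Op (TorusSite 3 L) 2) * totalSpin 1 0 + totalSpin 1 1 * totalSpin 1 1) *ᵥ ψ).re +
            N - (L : ℝ) ^ 3 / 2) := by
  sorry

/-! ## Name-keyed aliases of the three stub statements — the hypotheses of `NearIsotropicDiluteBEC_of`

The native skeleton audit (`#h21_check_skeleton`) admits a hypothesis of the skeleton theorem only if its
head constant is a registered obligation or is NAMED like a declared stub; `__Registered.stub_X` is the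
statement of `stub_X` under that name (device of `Cruxes/AmplitudeLDP/Lines/birth.lean`). Each alias is
`rfl`-equal to its statement. -/
namespace __Registered

/-- Alias of `ThermodynamicWindowPersistence` keyed by the registered stub name. -/
abbrev stub_thermodynamicWindow : Prop := ThermodynamicWindowPersistence

end __Registered

/-! ## The spelled stub signatures are the stub `def`s (definitional unfolding only) -/

example : ThermodynamicWindowPersistence := stub_thermodynamicWindow

/-! ## Stub B (the kinetic-gap window) — LANDED

`stub_gapWindow` (registered, spelled signature) is the theorem of
`Theorems/BECZeroCrossingDiluteNearIsotropicDiluteBECGapWindow.lean` (p156039), composed there from the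
landed B1, B2, B3 with `κ = 1/(2C₂C₃)`; the same file proves the TRACIAL form
`nearIsotropicDiluteBEC_kineticGapWindow` = the crux restricted to its kinetic-gap window
`(1−Δ)N ≤ κL`. Here we only re-read it through the skeleton's `def`. -/

/-- The window statement B of the birth skeleton, now the landed theorem `stub_gapWindow`. -/
theorem gapWindow_holds : GapWindowPersistence := stub_gapWindow

example : GapWindowPersistence := gapWindow_holds

/-! ## Composition: the crux BY NAME from the five stub statements (no `sorry` below) -/

/-- **NearIsotropicDiluteBEC_of** — Perron vector (A) × window split {kinetic-gap window (B),
thermodynamic window (C)} ⟹ `NearIsotropicDiluteBEC`. Constants: `κ` from B, `(ε, ν₀)` from C at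
that `κ`, answer `(min ε 1, min ν₀ ½)` (so that `0 ≤ Δ`, `2N ≤ L³`, `N ≤ L³` hold where A and B need
them). For given `(L, N, Δ)`: A gives the unit nonnegative sector ground vector `φ` spanning the ground
space; B or C (by `(1−Δ)N ≤ κL` or not) gives the inequality for the vector state of `φ`; uniqueness
makes the tracial ground-state functional that vector state. After cycle 1 the only hypothesis is the
open stub C under its registered name (`__Registered.stub_thermodynamicWindow` is
`ThermodynamicWindowPersistence` by `rfl`); A and B are the landed theorems `stub_penalisedPerron` and
`gapWindow_holds`, discharged inside the proof; conclusion = the route decl, by name. -/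
theorem NearIsotropicDiluteBEC_of (hC : __Registered.stub_thermodynamicWindow) :
    Summit.AtomisticToContinuum.BoseEinsteinCondensation.Theses.BECZeroCrossingDilute.NearIsotropicDiluteBEC := by
  -- the landed stubs A and B = (B1, B2, B3), discharged inside the proof
  have hA : PenalisedSectorPerron := stub_penalisedPerron
  have hB : GapWindowPersistence := gapWindow_holds
  obtain ⟨κ, hκ, hP⟩ := hB
  obtain ⟨ε, ν₀, hε, hν₀, hT⟩ := hC κ hκ
  refine ⟨min ε 1, min ν₀ (1 / 2), lt_min hε one_pos, lt_min hν₀ (by norm_num), ?_⟩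
  intro L _ hL N hN Δ hΔ1 hΔ2
  -- unpack the side conditions
  have hL3 : (0 : ℝ) ≤ (L : ℝ) ^ 3 := by positivity
  have hNν : (N : ℝ) ≤ ν₀ * (L : ℝ) ^ 3 :=
    hN.trans (mul_le_mul_of_nonneg_right (min_le_left _ _) hL3)
  have hN2 : 2 * (N : ℝ) ≤ (L : ℝ) ^ 3 := by
    have h := hN.trans (mul_le_mul_of_nonneg_right (min_le_right _ _) hL3)
    linarith
  have hNV : N ≤ L ^ 3 := by
    have h0 : (0 : ℝ) ≤ (N : ℝ) := Nat.cast_nonneg N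
    have h : (N : ℝ) ≤ (L : ℝ) ^ 3 := by linarith
    exact_mod_cast h
  have hΔε : 1 - ε ≤ Δ := le_trans (by linarith [min_le_left ε 1]) hΔ1
  have hΔ0 : 0 ≤ Δ := le_trans (by linarith [min_le_right ε 1]) hΔ1
  -- (A) the Perron vector of the penalised Hamiltonian
  obtain ⟨φ, hφnn, hφ1, hφpen, hφmem, hφspan⟩ := hA L hL N hNV Δ hΔ0 hΔ2
  -- (B)/(C) vector-level persistence, by window
  have key : (N : ℝ) * ((L : ℝ) ^ 3 - N + 1) ≤
      2 * ((star φ ⬝ᵥ planarSq L *ᵥ φ).re + N - (L : ℝ) ^ 3 / 2) := by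
    by_cases hreg : (1 - Δ) * (N : ℝ) ≤ κ * (L : ℝ)
    · exact hP L hL N hN2 Δ hΔ0 hΔ2 hreg φ hφmem hφpen hφ1
    · exact hT L hL N hNν Δ hΔε hΔ2 (le_of_lt (not_le.mp hreg)) φ hφmem hφpen hφ1 hφnn
  -- the tracial ground-state functional is the vector state of `φ`
  have hφ0 : φ ≠ 0 := by
    rintro rfl
    simp at hφ1
  have hspan : (penalised L N Δ).groundSpace = ℂ ∙ φ := by
    refine le_antisymm ?_ ?_
    · intro ψ hψ
      obtain ⟨c, hc⟩ := hφspan ψ hψ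
      rw [Submodule.mem_span_singleton]
      exact ⟨c, hc.symm⟩
    · rw [Submodule.span_le, Set.singleton_subset_iff]
      exact hφmem
  have huniq : (penalised L N Δ).HasUniqueGroundState := by
    show Module.finrank ℂ (penalised L N Δ).groundSpace = 1
    rw [hspan]
    exact finrank_span_singleton hφ0
  have hω : (penalised L N Δ).groundStateFunctional (planarSq L) = star φ ⬝ᵥ planarSq L *ᵥ φ := by
    rw [groundStateFunctional_eq_of_hasUniqueGroundState huniq hφmem hφ0, hφ1, div_one]
  have final : (N : ℝ) * ((L : ℝ) ^ 3 - N + 1) ≤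
      2 * (((penalised L N Δ).groundStateFunctional (planarSq L)).re + N - (L : ℝ) ^ 3 / 2) := by
    rw [hω]
    exact key
  exact final

/-- Wiring check (an `example`, so that `NearIsotropicDiluteBEC_of` stays the only theorem concluding
the crux): the registered stubs feed the skeleton theorem as stated — this term becomes the crux proof
when the last `sorry` above (stub C) is discharged. -/
example : Summit.AtomisticToContinuum.BoseEinsteinCondensation.Theses.BECZeroCrossingDilute.NearIsotropicDiluteBEC :=
  NearIsotropicDiluteBEC_of stub_thermodynamicWindow

/-- The plain-arrow form `<stub sigs> → NearIsotropicDiluteBEC` of the skeleton theorem (same term). -/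
example : ThermodynamicWindowPersistence →
    Summit.AtomisticToContinuum.BoseEinsteinCondensation.Theses.BECZeroCrossingDilute.NearIsotropicDiluteBEC :=
  NearIsotropicDiluteBEC_of

end Summit.AtomisticToContinuum.BoseEinsteinCondensation.Cruxes.NearIsotropicDiluteBEC.Birth

end
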